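import Summits.AtomisticToContinuum.HydrodynamicLimit.Theorems.InformationPercolationEnginePercolationClosesChaosDockingTiling
import Literature.MathematicalPhysics.KineticTheory.HardSphereCampbellAEMeasurable
import HarnessLib

/-!
# Docking S7 of the line `equilibrium-forecast-chain-rule` (crux `InformationPercolationEngine.PercolationClosesChaos`,
stmt-AtomisticToContinuum-15178) — piece M: a.e.-measurability of the averaged kinetic statistics

Support file (`--supports stmt-AtomisticToContinuum-15178`) of the registered stub `stub_docking` (worker S7-M of lead c3).
The probabilistic assembly of the docking (`docking_of_aemeasurable`, piece G) turns the `lintegral` bounds of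
`KineticCellChaosLG` and `LocalCountUI` (i) into probability bounds by Markov's inequality under the local Gibbs law
`LG ≪ liouville`, which needs the integrands — the unit averages of `badWeight Ψ η T` and of the truncated row counts
`rowCount · 𝟙{T < rowCount}` — to be a.e.-measurable for the Liouville measure. This file proves exactly those two
registered facts, `aemeasurable_unitAvg_badWeight` and `aemeasurable_unitAvg_rowCount_trunc`.

The engine (§1) is Alexander's collision-by-collision dictionary, as in
`Literature.MathematicalPhysics.KineticTheory.aemeasurable_collisionPairSum`, but for REAL-valued marks that may also
depend (jointly measurably) on the initial datum `z` — the cell-pair statistics of the line label a collision by the START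
CELLS of its two members, a function of `z` through the fixed-time flow map: on the good set the collision pair sum over
`(0, t]` is the enumerated sum over `m < collisionCount z t` of the contact-pair sums at the post-collisional states
`stateAfter z (m+1)` (`collisionPairSum_flow_eq_sum_stateAfter`), a measurable function of `z`
(`Alexander.measurable_stateAfter`, `Alexander.measurable_collisionCount`, `measurable_from_prod_countable_left`), and
the good set is Liouville-conull; a step window `(kΔ, (k+1)Δ]` is a difference of two such windows
(`collisionPairSum_Ioc_eq_sum_stepWindow`). §2: start-cell events, marks and the flux average `fluxAvg = sphereMark`
(jointly continuous for a continuous mark, `continuous_sphereMark_uncurry`) are measurable. §3: `collPair`, `rowCount`,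
`ownedCount` (a.e.), `pairPair` (everywhere), hence `relDefect`, `unitDefect` (its `tsum` over cells is a finite sum over
the box `cellBox`), `badWeight`, and the unit averages (`unitAvg_eq_sum`: finite sums for box-supported families).

Bookkeeping only (CIP 1994 §4.2, App. 4.A; GST 2013 Prop. 4.1.1: the flow is Borel and finitely many collisions happen
in bounded windows on the good set).
-/

noncomputable section

open MeasureTheory Set Filter Topology
open scoped ENNReal BigOperators Classical
open Literature.Analysis.FluidPDE Literature.MathematicalPhysics.KineticTheory
open Literature.MathematicalPhysics.KineticTheory.VelocityBlindPlacement

namespace Summit.AtomisticToContinuum.HydrodynamicLimit.Theorems.EquilibriumForecastLine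

/-! ## §1 The engine: collision pair sums of datum-dependent real marks are a.e.-measurable -/

section Engine

variable {σ : ℝ} {N : ℕ}

/-- The contact-pair sum of a jointly measurable (datum, configuration)-mark at the `m`-th post-collisional state is a
measurable function of the datum. [folklore] -/
theorem measurable_sum_contactPairs_stateAfter (hε : hsDiameter σ N < 2⁻¹) (m : ℕ)
    {g : Phase N → Phase N → Fin (N + 1) → Fin (N + 1) → ℝ}
    (hg : ∀ i j, Measurable fun p : Phase N × Phase N => g p.1 p.2 i j) :
    Measurable fun z : Phase N =>
      ∑ p ∈ contactPairs G3 (hsDiameter σ N) (Alexander.stateAfter G3 (hsDiameter σ N) z m),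
        g z (Alexander.stateAfter G3 (hsDiameter σ N) z m) p.1 p.2 := by
  have hG := Torus.isHardSphereRegular_geometry (d := Fin 3) hε
  have hGm : G3.IsMeasurable := Torus.isMeasurable_geometry
  have hS := Alexander.measurable_stateAfter (N := N + 1) hG hGm m
  have heq : (fun z : Phase N =>
      ∑ p ∈ contactPairs G3 (hsDiameter σ N) (Alexander.stateAfter G3 (hsDiameter σ N) z m),
        g z (Alexander.stateAfter G3 (hsDiameter σ N) z m) p.1 p.2) =
      fun z => ∑ p : Fin (N + 1) × Fin (N + 1),
        if p ∈ contactPairs G3 (hsDiameter σ N) (Alexander.stateAfter G3 (hsDiameter σ N) z m)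
        then g z (Alexander.stateAfter G3 (hsDiameter σ N) z m) p.1 p.2 else 0 := by
    funext z
    rw [Finset.sum_ite_mem, Finset.univ_inter]
  rw [heq]
  refine Finset.measurable_sum _ fun p _ =>
    Measurable.ite ?_ ((hg p.1 p.2).comp (measurable_id.prodMk hS)) measurable_const
  have hset : {z : Phase N | p ∈ contactPairs G3 (hsDiameter σ N) (Alexander.stateAfter G3 (hsDiameter σ N) z m)} =
      (fun z => Alexander.stateAfter G3 (hsDiameter σ N) z m) ⁻¹'
        {w | p.1 ≠ p.2 ∧ w ∈ contactSet G3 (N + 1) (hsDiameter σ N) p.1 p.2} := by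
    ext z
    simp only [mem_setOf_eq, mem_preimage, mem_contactPairs]
  rw [hset]
  refine hS ?_
  by_cases hp : p.1 = p.2
  · have : {w : Phase N | p.1 ≠ p.2 ∧ w ∈ contactSet G3 (N + 1) (hsDiameter σ N) p.1 p.2} = ∅ := by
      ext w; simp [hp]
    rw [this]
    exact MeasurableSet.empty
  · have : {w : Phase N | p.1 ≠ p.2 ∧ w ∈ contactSet G3 (N + 1) (hsDiameter σ N) p.1 p.2} =
        contactSet G3 (N + 1) (hsDiameter σ N) p.1 p.2 := by
      ext w; simp [hp]
    rw [this]
    exact measurableSet_contactSet _ Torus.measurable_geometry_sepVec (N + 1) (hsDiameter σ N) p.1 p.2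

/-- A finite sum of measurably many measurable summands, `a ↦ Σ_{m < K a} F m a` with `K` measurable, is measurable
(through the countable second factor of `α × ℕ`, `measurable_from_prod_countable_left`). [folklore] -/
theorem measurable_sum_range_of_measurable_len {α : Type*} [MeasurableSpace α] {K : α → ℕ} (hK : Measurable K)
    {F : ℕ → α → ℝ} (hF : ∀ m, Measurable (F m)) :
    Measurable fun a => ∑ m ∈ Finset.range (K a), F m a := by
  have hH : Measurable fun p : α × ℕ => ∑ m ∈ Finset.range p.2, F m p.1 := by
    refine measurable_from_prod_countable_left fun n => ?_
    show Measurable fun a => ∑ m ∈ Finset.range n, F m a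
    exact Finset.measurable_sum _ fun m _ => hF m
  exact hH.comp (measurable_id.prodMk hK)

/-- **Alexander's enumerated sum of a jointly measurable (datum, configuration)-mark is measurable in the datum**: the sum
over `m < collisionCount z t` of the contact-pair sums at `stateAfter z (m+1)` (`Alexander.measurable_collisionCount`,
`Alexander.measurable_stateAfter`). [folklore] -/
theorem measurable_sum_range_collisionCount (hε : hsDiameter σ N < 2⁻¹) (t : ℝ)
    {g : Phase N → Phase N → Fin (N + 1) → Fin (N + 1) → ℝ}
    (hg : ∀ i j, Measurable fun p : Phase N × Phase N => g p.1 p.2 i j) :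
    Measurable fun z : Phase N =>
      ∑ m ∈ Finset.range (Alexander.collisionCount G3 (hsDiameter σ N) z t),
        ∑ p ∈ contactPairs G3 (hsDiameter σ N) (Alexander.stateAfter G3 (hsDiameter σ N) z (m + 1)),
          g z (Alexander.stateAfter G3 (hsDiameter σ N) z (m + 1)) p.1 p.2 := by
  have hG := Torus.isHardSphereRegular_geometry (d := Fin 3) hε
  have hGm : G3.IsMeasurable := Torus.isMeasurable_geometry
  exact measurable_sum_range_of_measurable_len (Alexander.measurable_collisionCount (N := N + 1) hG hGm t)
    (F := fun m z => ∑ p ∈ contactPairs G3 (hsDiameter σ N) (Alexander.stateAfter G3 (hsDiameter σ N) z (m + 1)),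
      g z (Alexander.stateAfter G3 (hsDiameter σ N) z (m + 1)) p.1 p.2)
    fun m => measurable_sum_contactPairs_stateAfter hε (m + 1) hg

/-- **The engine.** For a hard-sphere flow of the crux (`ε_N < 1/2`) and a REAL mark `g z w i j` of (datum, current
configuration, ordered pair), jointly measurable in (datum, configuration), the collision pair sum over `(0, t]` along the
orbit of `z`, `z ↦ Φ.collisionPairSum (Ioc 0 t) (fun _ w i j => g z w i j) z`, is a.e.-measurable for the Liouville measure:
it agrees on the conull good set with Alexander's enumerated sum. [folklore] -/
theorem aemeasurable_collisionPairSum_Ioc (Φ : Flow σ N) (hε : hsDiameter σ N < 2⁻¹)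
    {g : Phase N → Phase N → Fin (N + 1) → Fin (N + 1) → ℝ}
    (hg : ∀ i j, Measurable fun p : Phase N × Phase N => g p.1 p.2 i j) (t : ℝ) :
    AEMeasurable (fun z => Φ.collisionPairSum (Ioc 0 t) (fun _ w i j => g z w i j) z)
      (liouville G3 (N + 1) (hsDiameter σ N)) := by
  rcases le_or_gt t 0 with ht | ht
  · have h0 : (fun z => Φ.collisionPairSum (Ioc 0 t) (fun _ w i j => g z w i j) z) = fun _ => 0 := by
      funext z
      unfold HardSphereFlow.collisionPairSum
      rw [Ioc_eq_empty (not_lt.2 ht), collisionPairSum_empty]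
    rw [h0]
    exact aemeasurable_const
  · refine (measurable_sum_range_collisionCount hε t hg).aemeasurable.congr ?_
    filter_upwards [Φ.ae_mem_good] with z hz
    exact (collisionPairSum_flow_eq_sum_stateAfter hε Φ hz ht.le (g z)).symm

/-- **The engine on a step window**: the collision pair sum of a jointly measurable real (datum, configuration)-mark over
the step window `(kΔ, (k+1)Δ]` is a.e.-measurable (Liouville) — on the good set it is the difference of the sums over
`(0, (k+1)Δ]` and `(0, kΔ]`. [folklore] -/
theorem aemeasurable_collisionPairSum_stepWindow (Φ : Flow σ N) (hσ : 0 < σ) (hσ2 : σ < 2⁻¹) {c : ℝ} (hc : 0 < c)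
    {g : Phase N → Phase N → Fin (N + 1) → Fin (N + 1) → ℝ}
    (hg : ∀ i j, Measurable fun p : Phase N × Phase N => g p.1 p.2 i j) (k : ℕ) :
    AEMeasurable (fun z => Φ.collisionPairSum (stepWindow c σ N k) (fun _ w i j => g z w i j) z)
      (liouville G3 (N + 1) (hsDiameter σ N)) := by
  have hε : hsDiameter σ N < 2⁻¹ := (hsDiameter_le hσ.le N).trans_lt hσ2
  refine ((aemeasurable_collisionPairSum_Ioc Φ hε hg (((k + 1 : ℕ) : ℝ) * stepLen c σ N)).sub
    (aemeasurable_collisionPairSum_Ioc Φ hε hg ((k : ℝ) * stepLen c σ N))).congr ?_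
  filter_upwards [Φ.ae_mem_good] with z hz
  show Φ.collisionPairSum (Ioc 0 (((k + 1 : ℕ) : ℝ) * stepLen c σ N)) (fun _ w i j => g z w i j) z -
      Φ.collisionPairSum (Ioc 0 ((k : ℝ) * stepLen c σ N)) (fun _ w i j => g z w i j) z =
    Φ.collisionPairSum (stepWindow c σ N k) (fun _ w i j => g z w i j) z
  rw [collisionPairSum_Ioc_eq_sum_stepWindow Φ hz hc hσ _ (k + 1), collisionPairSum_Ioc_eq_sum_stepWindow Φ hz hc hσ _ k,
    Finset.sum_range_succ, add_sub_cancel_left]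

end Engine

/-! ## §2 Start-cell events, marks and flux averages are measurable -/

section Marks

variable {σ : ℝ} {N : ℕ}

/-- The start cell of a sphere is a measurable function of the datum (fixed-time flow map, `Torus.coarseCell`). [folklore] -/
theorem measurable_startCell (Φ : Flow σ N) (c : ℝ) (k : ℕ) (i : Fin (N + 1)) :
    Measurable fun z : Phase N => startCell c σ N Φ k z i :=
  (Torus.measurable_coarseCell _).comp ((measurable_pi_apply i).comp (Φ.measurable_flow _)).fst

/-- Start-cell events are measurable. [folklore] -/
theorem measurableSet_startCell_eq (Φ : Flow σ N) (c : ℝ) (k : ℕ) (i : Fin (N + 1)) (q : Cell) :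
    MeasurableSet {z : Phase N | startCell c σ N Φ k z i = q} :=
  measurable_startCell Φ c k i (measurableSet_singleton q)

/-- Owner events (lex-min of two start cells) are measurable. [folklore] -/
theorem measurableSet_cellMin_startCell_eq (Φ : Flow σ N) (c : ℝ) (k : ℕ) (i j : Fin (N + 1)) (q : Cell) :
    MeasurableSet {z : Phase N | cellMin (startCell c σ N Φ k z i) (startCell c σ N Φ k z j) = q} := by
  have h : Measurable fun z : Phase N => cellMin (startCell c σ N Φ k z i) (startCell c σ N Φ k z j) :=
    (measurable_of_countable fun pq : Cell × Cell => cellMin pq.1 pq.2).comp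
      ((measurable_startCell Φ c k i).prodMk (measurable_startCell Φ c k j))
  exact h (measurableSet_singleton q)

/-- The pre-collisional mark of an ordered pair is a measurable function of the configuration. [folklore] -/
theorem measurable_markOf (N : ℕ) (ε : ℝ) (i j : Fin (N + 1)) : Measurable fun w : Phase N => markOf N ε w i j := by
  have hx : ∀ k : Fin (N + 1), Measurable fun w : Phase N => (w k).1 := fun k => (measurable_pi_apply k).fst
  have hv : ∀ k : Fin (N + 1), Measurable fun w : Phase N => (w k).2 := fun k => (measurable_pi_apply k).snd
  have hn : Measurable fun w : Phase N => G3.sepVec (w i).1 (w j).1 :=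
    Torus.measurable_geometry_sepVec.comp ((hx i).prodMk (hx j))
  unfold markOf
  exact (hn.const_smul ε⁻¹).prodMk (measurable_reflectVel.comp (hn.prodMk ((hv i).prodMk (hv j))))

/-- The flux average of a continuous mark test is jointly measurable in the two velocities (`fluxAvg = sphereMark`, jointly
continuous). [folklore] -/
theorem measurable_fluxAvg {Ξ : V3 × V3 × V3 → ℝ} (hΞ : Continuous Ξ) : Measurable fun p : V3 × V3 => fluxAvg Ξ p.1 p.2 :=
  (continuous_sphereMark_uncurry hΞ).measurable

end Marks

/-! ## §3 The statistics of a step and their unit averages -/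

section Stats

variable {σ : ℝ} {N : ℕ} (Φ : Flow σ N)

/-- `collPair Ψ` is a.e.-measurable (Liouville) for a measurable mark test. [folklore] -/
theorem aemeasurable_collPair (hσ : 0 < σ) (hσ2 : σ < 2⁻¹) {Ψ : V3 × V3 × V3 → ℝ} (hΨ : Measurable Ψ) {c : ℝ}
    (hc : 0 < c) (k : ℕ) (q q' : Cell) :
    AEMeasurable (fun z : Phase N => collPair Ψ c σ N Φ k q q' z) (liouville G3 (N + 1) (hsDiameter σ N)) := by
  unfold collPair
  refine aemeasurable_const.mul (aemeasurable_collisionPairSum_stepWindow Φ hσ hσ2 hc (g := fun z w i j =>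
    if startCell c σ N Φ k z i = q ∧ startCell c σ N Φ k z j = q' then Ψ (markOf N (hsDiameter σ N) w i j) else 0)
    (fun i j => ?_) k)
  refine Measurable.ite ?_ ((hΨ.comp (measurable_markOf N _ i j)).comp measurable_snd) measurable_const
  exact ((measurableSet_startCell_eq Φ c k i q).inter (measurableSet_startCell_eq Φ c k j q')).preimage measurable_fst

/-- `rowCount` is a.e.-measurable (Liouville). [folklore] -/
theorem aemeasurable_rowCount (hσ : 0 < σ) (hσ2 : σ < 2⁻¹) {c : ℝ} (hc : 0 < c) (k : ℕ) (q : Cell) :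
    AEMeasurable (fun z : Phase N => rowCount c σ N Φ k q z) (liouville G3 (N + 1) (hsDiameter σ N)) := by
  unfold rowCount
  refine aemeasurable_const.mul (aemeasurable_collisionPairSum_stepWindow Φ hσ hσ2 hc
    (g := fun z _ i _ => if startCell c σ N Φ k z i = q then (1 : ℝ) else 0) (fun i _ => ?_) k)
  exact Measurable.ite ((measurableSet_startCell_eq Φ c k i q).preimage measurable_fst) measurable_const measurable_const

/-- `ownedCount` is a.e.-measurable (Liouville). [folklore] -/
theorem aemeasurable_ownedCount (hσ : 0 < σ) (hσ2 : σ < 2⁻¹) {c : ℝ} (hc : 0 < c) (k : ℕ) (q : Cell) :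
    AEMeasurable (fun z : Phase N => ownedCount c σ N Φ k q z) (liouville G3 (N + 1) (hsDiameter σ N)) := by
  unfold ownedCount
  refine aemeasurable_const.mul (aemeasurable_collisionPairSum_stepWindow Φ hσ hσ2 hc
    (g := fun z _ i j => if cellMin (startCell c σ N Φ k z i) (startCell c σ N Φ k z j) = q then (1 : ℝ) else 0)
    (fun i j => ?_) k)
  exact Measurable.ite ((measurableSet_cellMin_startCell_eq Φ c k i j q).preimage measurable_fst) measurable_const
    measurable_const

/-- `pairPair Ξ` is measurable for a continuous mark test (fixed-time flow only). [folklore] -/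
theorem measurable_pairPair {Ξ : V3 × V3 × V3 → ℝ} (hΞ : Continuous Ξ) (c : ℝ) (k : ℕ) (q q' : Cell) :
    Measurable fun z : Phase N => pairPair Ξ c σ N Φ k q q' z := by
  have hv : ∀ i : Fin (N + 1), Measurable fun z : Phase N => ((Φ.flow ((k : ℝ) * stepLen c σ N) z) i).2 :=
    fun i => ((measurable_pi_apply i).comp (Φ.measurable_flow _)).snd
  unfold pairPair
  refine measurable_const.mul (Finset.measurable_sum _ fun i _ => Finset.measurable_sum _ fun j _ => ?_)
  refine Measurable.ite ?_ ((measurable_fluxAvg hΞ).comp ((hv i).prodMk (hv j))) measurable_const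
  exact measurableSet_setOf.2 (measurable_const.and ((measurableSet_setOf.1 (measurableSet_startCell_eq Φ c k i q)).and
    (measurableSet_setOf.1 (measurableSet_startCell_eq Φ c k j q'))))

/-- `relDefect Ψ` is a.e.-measurable (Liouville) for a continuous mark test. [folklore] -/
theorem aemeasurable_relDefect (hσ : 0 < σ) (hσ2 : σ < 2⁻¹) {Ψ : V3 × V3 × V3 → ℝ} (hΨ : Continuous Ψ) {c : ℝ}
    (hc : 0 < c) (k : ℕ) (q q' : Cell) :
    AEMeasurable (fun z : Phase N => relDefect Ψ c σ N Φ k q q' z) (liouville G3 (N + 1) (hsDiameter σ N)) := by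
  unfold relDefect
  exact ((aemeasurable_collPair Φ hσ hσ2 hΨ.measurable hc k q q').div
    (aemeasurable_collPair Φ hσ hσ2 measurable_const hc k q q')).sub
    ((measurable_pairPair Φ hΨ c k q q').aemeasurable.div (measurable_pairPair Φ continuous_const c k q q').aemeasurable)

/-- The `tsum` over cells in `unitDefect` is a finite sum over the box. [folklore] -/
theorem unitDefect_eq_sum {c : ℝ} (h : 0 < c * meanFreePath σ N) (Ψ : V3 × V3 × V3 → ℝ) (k : ℕ) (q : Cell)
    (z : Phase N) :
    unitDefect Ψ c σ N Φ k q z = (ownedCount c σ N Φ k q z)⁻¹ * ∑ q' ∈ cellBox (c * meanFreePath σ N),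
      (if q' = q then collPair (fun _ => 1) c σ N Φ k q q z * |relDefect Ψ c σ N Φ k q q z|
      else if q = cellMin q q' then
        collPair (fun _ => 1) c σ N Φ k q q' z * |relDefect Ψ c σ N Φ k q q' z| +
          collPair (fun _ => 1) c σ N Φ k q' q z * |relDefect Ψ c σ N Φ k q' q z|
      else 0) := by
  unfold unitDefect
  congr 1
  refine tsum_cell_eq_sum fun q' hq' => ?_
  have h1 : collPair (fun _ => 1) c σ N Φ k q q' z = 0 := collPair_eq_zero_of_not_mem h _ Φ k (Or.inr hq') z
  have h2 : collPair (fun _ => 1) c σ N Φ k q' q z = 0 := collPair_eq_zero_of_not_mem h _ Φ k (Or.inl hq') z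
  by_cases hq : q' = q
  · subst hq
    rw [if_pos rfl, h1, zero_mul]
  · rw [if_neg hq]
    split_ifs
    · rw [h1, h2, zero_mul, zero_mul, add_zero]
    · rfl

/-- An `ite` on a proposition NOT depending on the point, of two a.e.-measurable functions, is a.e.-measurable (stated to
avoid evaluating `Decidable` instances on cell indices inside `simp`). [folklore] -/
theorem aemeasurable_ite_const {α β : Type*} [MeasurableSpace α] [MeasurableSpace β] {μ : Measure α} (P : Prop)
    [Decidable P] {f g : α → β} (hf : AEMeasurable f μ) (hg : AEMeasurable g μ) :
    AEMeasurable (fun a => if P then f a else g a) μ := by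
  by_cases hP : P
  · exact hf.congr (Eventually.of_forall fun a => (if_pos hP).symm)
  · exact hg.congr (Eventually.of_forall fun a => (if_neg hP).symm)

/-- `unitDefect Ψ` is a.e.-measurable (Liouville) for a continuous mark test. [folklore] -/
theorem aemeasurable_unitDefect (hσ : 0 < σ) (hσ2 : σ < 2⁻¹) {Ψ : V3 × V3 × V3 → ℝ} (hΨ : Continuous Ψ) {c : ℝ}
    (hc : 0 < c) (k : ℕ) (q : Cell) :
    AEMeasurable (fun z : Phase N => unitDefect Ψ c σ N Φ k q z) (liouville G3 (N + 1) (hsDiameter σ N)) := by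
  have h : 0 < c * meanFreePath σ N := mul_pos hc (meanFreePath_pos hσ N)
  have h1 := fun q q' => aemeasurable_collPair Φ hσ hσ2 measurable_const hc k q q' (Ψ := fun _ => 1)
  have hr := fun q q' => continuous_abs.measurable.comp_aemeasurable (aemeasurable_relDefect Φ hσ hσ2 hΨ hc k q q')
  rw [show (fun z : Phase N => unitDefect Ψ c σ N Φ k q z) = _ from funext (unitDefect_eq_sum Φ h Ψ k q)]
  refine (aemeasurable_ownedCount Φ hσ hσ2 hc k q).inv.mul (Finset.aemeasurable_fun_sum _ fun q' _ => ?_)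
  refine aemeasurable_ite_const (q' = q) ?_ (aemeasurable_ite_const (q = cellMin q q') ?_ aemeasurable_const)
  · exact (h1 q q).mul (hr q q)
  · exact ((h1 q q').mul (hr q q')).add ((h1 q' q).mul (hr q' q))

/-- `badWeight Ψ η T` is a.e.-measurable (Liouville) for a continuous mark test. [folklore] -/
theorem aemeasurable_badWeight (hσ : 0 < σ) (hσ2 : σ < 2⁻¹) {Ψ : V3 × V3 × V3 → ℝ} (hΨ : Continuous Ψ) (η T : ℝ)
    {c : ℝ} (hc : 0 < c) (k : ℕ) (q : Cell) :
    AEMeasurable (fun z : Phase N => badWeight Ψ η T c σ N Φ k q z) (liouville G3 (N + 1) (hsDiameter σ N)) := by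
  have hι : Measurable fun x : ℝ => if η < x then (1 : ℝ) else 0 :=
    Measurable.ite measurableSet_Ioi measurable_const measurable_const
  unfold badWeight
  exact ((aemeasurable_ownedCount Φ hσ hσ2 hc k q).min aemeasurable_const).mul
    (hι.comp_aemeasurable (aemeasurable_unitDefect Φ hσ hσ2 hΨ hc k q))

/-- The truncated row count `rowCount · 𝟙{T < rowCount}` is a.e.-measurable (Liouville). [folklore] -/
theorem aemeasurable_rowCount_trunc (hσ : 0 < σ) (hσ2 : σ < 2⁻¹) (T : ℝ) {c : ℝ} (hc : 0 < c) (k : ℕ) (q : Cell) :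
    AEMeasurable (fun z : Phase N => rowCount c σ N Φ k q z * (if T < rowCount c σ N Φ k q z then 1 else 0))
      (liouville G3 (N + 1) (hsDiameter σ N)) := by
  have hι : Measurable fun x : ℝ => if T < x then (1 : ℝ) else 0 :=
    Measurable.ite measurableSet_Ioi measurable_const measurable_const
  exact (aemeasurable_rowCount Φ hσ hσ2 hc k q).mul (hι.comp_aemeasurable (aemeasurable_rowCount Φ hσ hσ2 hc k q))

end Stats

/-! ## §4 The two registered facts -/

/-- **Registered stub `aemeasurable_unitAvg_badWeight` (piece M of the docking S7): the unit average of the increments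
`badWeight Ψ η T` is a.e.-measurable for the Liouville measure** (`0 < σ < 1/2`, `Ψ` continuous, `0 ≤ T`, `0 < c`): a finite
sum over steps `k < K_N` and cells of the box (`unitAvg_eq_sum`, `badWeight` vanishes off the box for `0 ≤ T`) of
a.e.-measurable functions (`aemeasurable_badWeight`). [folklore] -/
theorem aemeasurable_unitAvg_badWeight : ∀ {σ : ℝ} {N : ℕ} (Φ : Flow σ N), 0 < σ → σ < 2⁻¹ → ∀ (Ψ : V3 × V3 × V3 → ℝ), Continuous Ψ → ∀ (η T c τ : ℝ), 0 ≤ T → 0 < c → AEMeasurable (fun z : Phase N => unitAvg c σ N τ (fun k q => badWeight Ψ η T c σ N Φ k q z)) (liouville G3 (N + 1) (hsDiameter σ N)) := by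
  intro σ N Φ hσ hσ2 Ψ hΨ η T c τ hT hc
  have hh : 0 < c * meanFreePath σ N := mul_pos hc (meanFreePath_pos hσ N)
  have heq : (fun z : Phase N => unitAvg c σ N τ (fun k q => badWeight Ψ η T c σ N Φ k q z)) = fun z =>
      ((numSteps c σ N τ : ℝ))⁻¹ * (c * meanFreePath σ N) ^ 3 *
        ∑ k ∈ Finset.range (numSteps c σ N τ), ∑ q ∈ cellBox (c * meanFreePath σ N), badWeight Ψ η T c σ N Φ k q z := by
    funext z
    exact unitAvg_eq_sum c σ N τ _ fun k q hq => badWeight_eq_zero_of_not_mem hh Ψ η hT Φ k hq z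
  rw [heq]
  exact aemeasurable_const.mul (Finset.aemeasurable_fun_sum _ fun k _ => Finset.aemeasurable_fun_sum _ fun q _ =>
    aemeasurable_badWeight Φ hσ hσ2 hΨ η T hc k q)

/-- **Registered stub `aemeasurable_unitAvg_rowCount_trunc` (piece M of the docking S7): the unit average of the truncated
row counts `rowCount · 𝟙{T < rowCount}` is a.e.-measurable for the Liouville measure** (`0 < σ < 1/2`, `0 < c`): a finite
sum over steps and cells of the box (`unitAvg_eq_sum`, `rowCount` vanishes off the box) of a.e.-measurable functions
(`aemeasurable_rowCount_trunc`). [folklore] -/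
theorem aemeasurable_unitAvg_rowCount_trunc : ∀ {σ : ℝ} {N : ℕ} (Φ : Flow σ N), 0 < σ → σ < 2⁻¹ → ∀ (T c τ : ℝ), 0 < c → AEMeasurable (fun z : Phase N => unitAvg c σ N τ (fun k q => rowCount c σ N Φ k q z * (if T < rowCount c σ N Φ k q z then 1 else 0))) (liouville G3 (N + 1) (hsDiameter σ N)) := by
  intro σ N Φ hσ hσ2 T c τ hc
  have hh : 0 < c * meanFreePath σ N := mul_pos hc (meanFreePath_pos hσ N)
  have heq : (fun z : Phase N => unitAvg c σ N τ
      (fun k q => rowCount c σ N Φ k q z * (if T < rowCount c σ N Φ k q z then 1 else 0))) = fun z =>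
      ((numSteps c σ N τ : ℝ))⁻¹ * (c * meanFreePath σ N) ^ 3 *
        ∑ k ∈ Finset.range (numSteps c σ N τ), ∑ q ∈ cellBox (c * meanFreePath σ N),
          rowCount c σ N Φ k q z * (if T < rowCount c σ N Φ k q z then 1 else 0) := by
    funext z
    refine unitAvg_eq_sum c σ N τ _ fun k q hq => ?_
    show rowCount c σ N Φ k q z * (if T < rowCount c σ N Φ k q z then 1 else 0) = 0
    rw [rowCount_eq_zero_of_not_mem hh Φ k hq z, zero_mul]
  rw [heq]
  exact aemeasurable_const.mul (Finset.aemeasurable_fun_sum _ fun k _ => Finset.aemeasurable_fun_sum _ fun q _ =>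
    aemeasurable_rowCount_trunc Φ hσ hσ2 T hc k q)

end Summit.AtomisticToContinuum.HydrodynamicLimit.Theorems.EquilibriumForecastLine

end
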